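import Summits.ResolutionOfSingularities.ResolutionOfSingularities.Theorems.FrobeniusLadderFInjectiveMacaulayficationFHalfRowOfNewtonNondegenerateFree
import Summits.ResolutionOfSingularities.ResolutionOfSingularities.Theorems.FrobeniusLadderFInjectiveMacaulayficationMonomialCoverMultiRecord
import HarnessLib

/-!
# (W-ND) the tame-rung class row IN THE CURRENCY OF THE TORIC COVER FACT F-108 «F-TC» (`ToricCoverFactProduct`): the consumer of R21.8 (3)
# (crux `FInjectiveMacaulayfication` stmt-ResolutionOfSingularities-15315, chain w45a; res-L1-w45a-plan-1 RULINGS R21.8 (3)/(5) «stub-1 writes the consumer twin of F-108», R21.12 (5)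
# «F-108 assembly»; seat res-L1-w45a-stub-1 g12; currency = res-inputs-plan-2 g9's typed sketch `plan/inputs/scan/tools-plan2-g9/Sketch_ToricCover_g9.lean` 8b8272da9f265f6c
# (`IsPrimaryToOrigin`, `VertexMinimises`, `ChartPresented`, `CommonMinimiser`, `CoverRecord`, product form `A = {e_i + b}`), critic R166/R167 GO-TYPE, desk R21.8 (3) ACCEPTED)

[OURS · L1 W4.5a] Support file (`--supports stmt-ResolutionOfSingularities-15315 --as helper`); def-free; UNCONDITIONAL; no named fact (F-108 itself is NOT assumed here: its
CONCLUSION for the given `f` is taken as explicit, unfolded data); NOT a statement of any manuscript. HONEST SCOPE: tame rung. AI-written (AI review weaker than expert review).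

* §1 translation lemmas (ns `NewtonChartLemma` / `FHalfRowOfToricCoverData`): `exists_theta_eq_monomial_mul_of_commonMinimiser` (COMMON MINIMISER ⇒ REFINING STRICT TRANSFORM:
  `u₀ ∈ supp f` minimising every row weight of the unimodular `V` ⇒ `θ_V f = Y^{V·u₀}·g`, `g(0) = a_{u₀} ≠ 0`), `span_image_prod_eq_mul` (`(x^{e_i+b} : i, b ∈ B) = 𝔪·(x^b : b ∈ B)`
  in any quotient of `k[X]`), `hcov_of_coverRecord` (F-108's `CoverRecord` ⇒ the `hcov` binder, via ✓ p627652's `prod_pow_mem_pow_sum` / `prod_monomial_one_pow`),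
  `hprim_of_product` / `hAJ_of_product`.
* §2 ★★★ `fHalfRow_of_toricCoverData` — for `k = k̄` of characteristic `p`, `f` prime, Newton non-degenerate, no variable a multiple, `V(f)` regular off the origin, and the
  CONCLUSION OF F-108 FOR `f` as data in F-108's own currency (`B` with pure powers; `A = {e_i + b}`; chart vertices `vtx c ∈ A`, unimodular `V c`, `VertexMinimises`,
  `ChartPresented`, `CommonMinimiser` on `supp f`, `CoverRecord` for every generator): the F-half's conclusion at the point floor of `Spec 𝒪_{X,v}` — ONE application of
  ✓ p653810 `fHalfRow_of_newtonNondegenerate'`. When F-108 lands as `ToricCoverFactProduct n`, the unconditional class theorem for CONVENIENT `f` is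
  `obtain ⟨B, t, vtx, V, hB, hcharts, hrec⟩ := F108 k f hconv; exact fHalfRow_of_toricCoverData …` (5 lines, filed then).
[cite: IshiiSingularities2018, Thm. 4.4.23, Lemma 4.4.24, Cor. 4.4.25 (pp. 95–97)] [cite: StacksProject, Tag 0804 and Tag 080A]
-/

-- single-problem summit: the doubled namespace component is forced
set_option linter.dupNamespace false

noncomputable section

open AlgebraicGeometry CategoryTheory Literature.AlgebraicGeometry.Resolution Literature.AlgebraicGeometry.Resolution.BoubakriGreuelMarkwig
  TopologicalSpace IsLocalRing MvPolynomial

namespace Summit.ResolutionOfSingularities.ResolutionOfSingularities.Theorems.FInjectiveMacaulayfication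

/-! ## §1 Translation lemmas -/

namespace NewtonChartLemma

variable {k : Type} [Field k] {m : ℕ}

/-- **Common minimiser ⇒ refining strict transform.** If `u₀ ∈ supp f` minimises EVERY row weight of `V` on `supp f` (the chart cone lies in the cone of the dual Newton fan at the
vertex `u₀`), then `θ_V f = Y^{V·u₀} · g` with `g = Σ_α a_α Y^{V·α − V·u₀}` and `g(0) = a_{u₀} ≠ 0` (`V` unimodular). [cite: IshiiSingularities2018, proof of Lemma 4.4.24 (p. 96)] -/
theorem exists_theta_eq_monomial_mul_of_commonMinimiser (V : Matrix (Fin m) (Fin m) ℕ) (hV : IsUnit (V.map (Nat.cast : ℕ → ℤ)).det) (f : MvPolynomial (Fin m) k)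
    (u₀ : Fin m →₀ ℕ) (hu₀ : u₀ ∈ f.support) (hmin : ∀ i : Fin m, ∀ u ∈ f.support, ∑ j, V i j * u₀ j ≤ ∑ j, V i j * u j) :
    ∃ g : MvPolynomial (Fin m) k,
      aeval (fun j : Fin m => ∏ i : Fin m, (X i : MvPolynomial (Fin m) k) ^ V i j) f =
        monomial (Finsupp.equivFunOnFinite.symm (V.mulVec ⇑u₀)) 1 * g ∧ constantCoeff g ≠ 0 := by
  classical
  set v : (Fin m →₀ ℕ) → (Fin m →₀ ℕ) := fun α => Finsupp.equivFunOnFinite.symm fun i => ∑ j, V i j * α j with hvdef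
  have hv : ∀ α i, v α i = ∑ j, V i j * α j := fun α i => by simp [hvdef]
  have hvu : Finsupp.equivFunOnFinite.symm (V.mulVec ⇑u₀) = v u₀ := by
    ext i; rw [hv]; simp [Matrix.mulVec, dotProduct]
  have hle : ∀ α ∈ f.support, v u₀ ≤ v α := fun α hα i => by rw [hv, hv]; exact hmin i α hα
  refine ⟨∑ α ∈ f.support, monomial (v α - v u₀) (coeff α f), ?_, ?_⟩
  · rw [hvu, aeval_eq_sum V f v hv, Finset.mul_sum]
    refine Finset.sum_congr rfl fun α hα => ?_
    rw [monomial_mul, one_mul, add_tsub_cancel_of_le (hle α hα)]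
  · have hinj := v_injective V hV v hv
    rw [show (constantCoeff : MvPolynomial (Fin m) k → k) = coeff 0 from constantCoeff_eq, coeff_sum]
    simp only [coeff_monomial]
    rw [Finset.sum_eq_single_of_mem u₀ hu₀]
    · rw [if_pos (tsub_self _)]
      exact mem_support_iff.mp hu₀
    · intro α hα hne
      rw [if_neg]
      intro h0
      exact hne (hinj (le_antisymm (tsub_eq_zero_iff_le.mp h0) (hle α hα)))

end NewtonChartLemma

namespace FHalfRowOfToricCoverData

open Summit.ResolutionOfSingularities.ResolutionOfSingularities.Theorems.FInjectiveMacaulayfication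
open SliceableCentre

variable {k : Type} [Field k] {n : ℕ}

/-- **Product form**: in any quotient `R = k[X]/F`, the monomials `x^{e_i + b}` (`i` a variable, `b ∈ B`) span `𝔪 · (x^b : b ∈ B)`. [folklore] -/
theorem span_image_prod_eq_mul (F : Ideal (MvPolynomial (Fin n) k)) (B A : Finset (Fin n →₀ ℕ))
    (hA : A = (Finset.univ ×ˢ B).image (fun q : Fin n × (Fin n →₀ ℕ) => Finsupp.single q.1 1 + q.2)) :
    Ideal.span ((fun e : Fin n →₀ ℕ => Ideal.Quotient.mk F (monomial e (1 : k))) '' (A : Set (Fin n →₀ ℕ))) =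
      Ideal.span (Set.range fun j : Fin n => Ideal.Quotient.mk F (X j)) *
        Ideal.span ((fun e : Fin n →₀ ℕ => Ideal.Quotient.mk F (monomial e (1 : k))) '' (B : Set (Fin n →₀ ℕ))) := by
  classical
  have hmono : ∀ (i : Fin n) (b : Fin n →₀ ℕ), Ideal.Quotient.mk F (monomial (Finsupp.single i 1 + b) (1 : k)) =
      Ideal.Quotient.mk F (X i) * Ideal.Quotient.mk F (monomial b (1 : k)) := by
    intro i b
    rw [← map_mul, X, monomial_mul, one_mul]
  apply le_antisymm
  · rw [Ideal.span_le]
    rintro _ ⟨e, he, rfl⟩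
    rw [hA, Finset.coe_image, Set.mem_image] at he
    obtain ⟨⟨i, b⟩, hq, rfl⟩ := he
    have hb : b ∈ B := (Finset.mem_product.mp (Finset.mem_coe.mp hq)).2
    show Ideal.Quotient.mk F (monomial (Finsupp.single i 1 + b) (1 : k)) ∈ _
    rw [hmono]
    exact Ideal.mul_mem_mul (Ideal.subset_span ⟨i, rfl⟩) (Ideal.subset_span ⟨b, Finset.mem_coe.mpr hb, rfl⟩)
  · rw [Ideal.span_mul_span, Ideal.span_le]
    rintro _ ⟨_, ⟨i, rfl⟩, _, ⟨b, hb, rfl⟩, rfl⟩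
    show Ideal.Quotient.mk F (X i) * Ideal.Quotient.mk F (monomial b (1 : k)) ∈ _
    rw [← hmono]
    refine Ideal.subset_span ⟨Finsupp.single i 1 + b, ?_, rfl⟩
    rw [hA, Finset.coe_image]
    exact ⟨(i, b), Finset.mem_coe.mpr (Finset.mem_product.mpr ⟨Finset.mem_univ i, hb⟩), rfl⟩

/-- **F-108's `CoverRecord` ⇒ the `hcov` binder** of `CICertificates.ciCertificates`: `K • a = v + Σ_b n_b • b + r` with `Σ_b n_b = K − 1` gives
`(x^a)^K = x^v · ((∏_b (x^b)^{n_b}) · x^r)` with the bracket in `I_A^{K−1}`. [folklore] -/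
theorem hcov_of_coverRecord (A : Finset (Fin n →₀ ℕ)) (vtx a : Fin n →₀ ℕ) (K : ℕ) (nn : (Fin n →₀ ℕ) → ℕ) (r : Fin n →₀ ℕ)
    (hsum : (∑ b ∈ A, nn b) = K - 1) (hrec : K • a = vtx + (∑ b ∈ A, nn b • b) + r) :
    ∃ y ∈ (Ideal.span ((fun b : Fin n →₀ ℕ => (monomial b (1 : k) : MvPolynomial (Fin n) k)) '' (A : Set (Fin n →₀ ℕ)))) ^ (K - 1),
      (monomial a (1 : k) : MvPolynomial (Fin n) k) ^ K = monomial vtx 1 * y := by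
  refine ⟨(∏ b ∈ A, (monomial b (1 : k) : MvPolynomial (Fin n) k) ^ nn b) * monomial r 1, ?_, ?_⟩
  · rw [← hsum]
    exact Ideal.mul_mem_right _ _ (MonomialCoverMultiRecord.prod_pow_mem_pow_sum A _ (fun b => (monomial b (1 : k) : MvPolynomial (Fin n) k)) nn
      (fun b hb => Ideal.subset_span ⟨b, hb, rfl⟩))
  · rw [MonomialCoverMultiRecord.prod_monomial_one_pow, monomial_pow, one_pow, hrec, monomial_mul, monomial_mul, mul_one, mul_one, add_assoc]

/-- Product form, pure powers: `x_j^{N+1} = x^{e_j + N e_j} ∈ A`. [folklore] -/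
theorem hprim_of_product (B A : Finset (Fin n →₀ ℕ))
    (hA : A = (Finset.univ ×ˢ B).image (fun q : Fin n × (Fin n →₀ ℕ) => Finsupp.single q.1 1 + q.2))
    (hB : ∀ i : Fin n, ∃ N : ℕ, 0 < N ∧ Finsupp.single i N ∈ B) :
    ∀ j ∈ (Finset.univ : Finset (Fin n)), ∃ N : ℕ, Finsupp.single j N ∈ A := by
  classical
  intro j _
  obtain ⟨N, -, hN⟩ := hB j
  refine ⟨1 + N, ?_⟩
  rw [hA, Finset.mem_image]
  exact ⟨(j, Finsupp.single j N), Finset.mem_product.mpr ⟨Finset.mem_univ j, hN⟩, by rw [Finsupp.single_add]⟩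

/-- Product form: every generator `e_i + b` involves the variable `i`. [folklore] -/
theorem hAJ_of_product (B A : Finset (Fin n →₀ ℕ))
    (hA : A = (Finset.univ ×ˢ B).image (fun q : Fin n × (Fin n →₀ ℕ) => Finsupp.single q.1 1 + q.2)) :
    ∀ a ∈ A, ∃ j ∈ (Finset.univ : Finset (Fin n)), 0 < a j := by
  classical
  intro a ha
  rw [hA, Finset.mem_image] at ha
  obtain ⟨⟨i, b⟩, -, rfl⟩ := ha
  exact ⟨i, Finset.mem_univ i, by simp⟩

/-! ## §2 ★★★ The class row on F-108-shaped cover data -/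

/-- ★★★ **THE TAME-RUNG CLASS ROW ON F-108-SHAPED COVER DATA.** `k = k̄` of characteristic `p`; `f ∈ k[X_0..X_{n-1}]` (`n ≥ 1`) PRIME, NEWTON NON-DEGENERATE, no variable a
multiple of `f`, `V(f)` regular off the origin; and — the CONCLUSION of the toric cover fact F-108 «F-TC» for `f`, in its own currency, as data — a finite `B` with a pure power of
every variable (`K = (x^b : b ∈ B)` is `𝔪`-primary), `A = {e_i + b}` (so `I_A = 𝔪·K`), chart vertices `vtx c ∈ A`, unimodular `V c` minimising at the vertex (`VertexMinimises`),
presented there (`ChartPresented`), with a COMMON MINIMISER on `supp f` (`CommonMinimiser`: the chart refines the dual Newton fan), and a `CoverRecord` for every generator.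
THEN for the origin `v`: every blowing up of `Spec 𝒪_{X,v}` along the point floor is cured by some `𝓚 ≠ ⊥` over the closed point ALL of whose blowings up are FULL at every stalk.
One application of `FHalfRowOfNewtonNondegenerate.fHalfRow_of_newtonNondegenerate'` after §1's translations. [OURS · tame rung; cite: IshiiSingularities2018, Thm. 4.4.23 and Cor. 4.4.25] -/
theorem fHalfRow_of_toricCoverData (p : ℕ) [Fact p.Prime] (k : Type) [Field k] [IsAlgClosed k] [CharP k p] {n : ℕ} (hn : 0 < n)
    (f : MvPolynomial (Fin n) k) (hfp : Prime f) (hND : IsNewtonNondegenerate (f : MvPowerSeries (Fin n) k))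
    (hXne : ∀ v : Fin n, Ideal.Quotient.mk (Ideal.span {f}) (X v) ≠ 0)
    (hreg : ∀ x : Spec (.of (MvPolynomial (Fin n) k ⧸ Ideal.span {f})),
      ¬ Ideal.span (Set.range fun j : Fin n => Ideal.Quotient.mk (Ideal.span {f}) (X j)) ≤ x.asIdeal → IsRegularLocalRing (Localization.AtPrime x.asIdeal))
    (B : Finset (Fin n →₀ ℕ)) (hB : ∀ i : Fin n, ∃ N : ℕ, 0 < N ∧ Finsupp.single i N ∈ B)
    (A : Finset (Fin n →₀ ℕ)) (hA : A = (Finset.univ ×ˢ B).image (fun q : Fin n × (Fin n →₀ ℕ) => Finsupp.single q.1 1 + q.2))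
    (t : ℕ) (vtx : Fin t → (Fin n →₀ ℕ)) (V : Fin t → Matrix (Fin n) (Fin n) ℕ)
    (hvA : ∀ c, vtx c ∈ A) (hV : ∀ c, IsUnit ((V c).map (Nat.cast : ℕ → ℤ)).det)
    (hge : ∀ (c : Fin t), ∀ e ∈ A, (Finsupp.equivFunOnFinite.symm ((V c).mulVec ⇑(vtx c)) : Fin n →₀ ℕ) ≤ Finsupp.equivFunOnFinite.symm ((V c).mulVec ⇑e))
    (hpres : ∀ c : Fin t, ∃ a : Fin n → (Fin n →₀ ℕ), (∀ i, a i ∈ A) ∧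
      ∀ i, (Finsupp.equivFunOnFinite.symm ((V c).mulVec ⇑(a i)) : Fin n →₀ ℕ) = Finsupp.equivFunOnFinite.symm ((V c).mulVec ⇑(vtx c)) + Finsupp.single i 1)
    (hmin : ∀ c : Fin t, ∃ u₀ : Fin n →₀ ℕ, u₀ ∈ f.support ∧ ∀ i : Fin n, ∀ u ∈ f.support, ∑ j, V c i j * u₀ j ≤ ∑ j, V c i j * u j)
    (hrec : ∀ a ∈ A, ∃ (c : Fin t) (K : ℕ) (nn : (Fin n →₀ ℕ) → ℕ) (r : Fin n →₀ ℕ),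
      1 ≤ K ∧ (∑ b ∈ A, nn b) = K - 1 ∧ K • a = vtx c + (∑ b ∈ A, nn b • b) + r)
    (v : Spec (.of (MvPolynomial (Fin n) k ⧸ Ideal.span {f})))
    (hvm : v.asIdeal = Ideal.span (Set.range fun j : Fin n => Ideal.Quotient.mk (Ideal.span {f}) (X j))) :
    ∀ (S' : Scheme.{0}) (gS : S' ⟶ Spec ((Spec (.of (MvPolynomial (Fin n) k ⧸ Ideal.span {f}))).presheaf.stalk v)),
      IsBlowup gS ((affineBlowup.idealSheaf (Ideal.span (Set.range fun j : Fin n => Ideal.Quotient.mk (Ideal.span {f}) (X j)))).comap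
        ((Spec (.of (MvPolynomial (Fin n) k ⧸ Ideal.span {f}))).fromSpecStalk v)) →
      ∃ 𝓚 : S'.IdealSheafData, 𝓚 ≠ ⊥ ∧
        (∀ s ∈ (𝓚.support : Set S'), gS.base s = closedPoint ((Spec (.of (MvPolynomial (Fin n) k ⧸ Ideal.span {f}))).presheaf.stalk v)) ∧
        ∀ (S'' : Scheme.{0}) (π : S'' ⟶ S'), IsBlowup π 𝓚 → ∀ s : S'', FullCl p (S''.presheaf.stalk s) := by
  classical
  -- chart presentations, refining strict transforms (choice)
  choose a haA hgen using hpres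
  choose u₀ hu₀ humin using hmin
  have hθg := fun c => NewtonChartLemma.exists_theta_eq_monomial_mul_of_commonMinimiser (V c) (hV c) f (u₀ c) (hu₀ c) (humin c)
  choose g hθ hg0 using hθg
  -- the cover inequality, primality data, the product identity, the vertices
  have hcov : ∀ a ∈ A, ∃ (c : Fin t) (K : ℕ), 1 ≤ K ∧ ∃ y ∈ (Ideal.span ((fun b : Fin n →₀ ℕ => (MvPolynomial.monomial b (1 : k) : MvPolynomial (Fin n) k)) '' (A : Set (Fin n →₀ ℕ)))) ^ (K - 1),
      (MvPolynomial.monomial a (1 : k) : MvPolynomial (Fin n) k) ^ K = MvPolynomial.monomial (vtx c) 1 * y := by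
    intro a' ha'
    obtain ⟨c, K, nn, r, hK, hsum, hrec'⟩ := hrec a' ha'
    exact ⟨c, K, hK, hcov_of_coverRecord A (vtx c) a' K nn r hsum hrec'⟩
  have hKprim : ∀ j : Fin n, ∃ N : ℕ, Finsupp.single j N ∈ B := fun j => by
    obtain ⟨N, -, hN⟩ := hB j
    exact ⟨N, hN⟩
  have hv : ∀ c : Fin t, Ideal.Quotient.mk (Ideal.span {f}) (monomial (vtx c) (1 : k)) ∈
      Ideal.span ((fun e : Fin n →₀ ℕ => Ideal.Quotient.mk (Ideal.span {f}) (monomial e (1 : k))) '' (A : Set (Fin n →₀ ℕ))) :=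
    fun c => Ideal.subset_span ⟨vtx c, Finset.mem_coe.mpr (hvA c), rfl⟩
  exact FHalfRowOfNewtonNondegenerate.fHalfRow_of_newtonNondegenerate' p k hn f hfp hND hXne hreg A B (span_image_prod_eq_mul (Ideal.span {f}) B A hA)
    hKprim (hprim_of_product B A hA hB) (hAJ_of_product B A hA) t vtx hcov V hV a haA hgen hge g
    (fun c => Finsupp.equivFunOnFinite.symm ((V c).mulVec ⇑(u₀ c))) hθ hg0 hv v hvm

end FHalfRowOfToricCoverData

end Summit.ResolutionOfSingularities.ResolutionOfSingularities.Theorems.FInjectiveMacaulayfication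

end
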